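import Summits.MatrixMultiplication.MatrixMultiplication.Theorems.AbelianSTPPCensusShapeCertVQDefs

/-!
# Abelian STPP census — the vQ certificate checker with the E3⁺ CONTINUATION BUDGET (`ShapeCertVQ.checkQE`): definitions

Cell mm-stpp, rung F-M1; successor kernel item VQ-CERT (T_E beyond 337 under vQ := vP ∧ E3⁺) in support of the closed crux item
stmt-MatrixMultiplication-19191; seat mm-stpp-vp-p2 (gen 1).

`checkQE M` is `ShapeCertVQ.checkQ M` (`…ShapeCertVQDefs`) with ONE change at every node: the packing budget `q` of the tail handed to
the candidate walk (first-member test, break level, closure) is `min q0 qE` instead of eng-2's `q0`, where `qE` is the **E3⁺ continuation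
budget** of the prefix: for a prefix member `t = (x,y,z)`, `V = xyz`, `2V > M`, with E3⁺ slacks `s_X = M − V − S_X` (`S_X` = the prefix's
off-member packing sums; untruncated) in the exact regime `s_A + s_B + s_C ≤ V` and `f := e3pL M V x y z s_A s_B s_C ≤ V²`
(`STPPThreeRoomEnergy.e3pL`, eng-2 g5 p519811), every vQ-admissible family above the prefix has tail packing mass
`Σ_tail (ab + bc + ca) ≤ (V² − f) / (M + 1 − (largest pair-sum of sides of t))` — rule U14 bounds the tail's letter sums by the slacks,
so the family stays in the exact regime, where `e3pL` is affine with slope at least `M + 1 − (pair-sum)` per unit of mass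
(`…ShapeCertVQSearchE.AboveQ.tail_uu_le_qE`).  Above the vP wall the search mostly enumerates completions of one big member by many
tiny ones, which E3⁺ kills one at a time; the budget prunes them at the root of that enumeration (seat sizing, same verdicts: candidate
visits 360: 4.3·10⁴ → 7.0·10³, 400: 3.2·10⁵ → 1.1·10⁴, 440: 1.6·10⁶ → 6.3·10⁴).
Also here: `rootSegQE` (root segments of `checkQE`, as `rootSegQ`).  Soundness: `…ShapeCertVQSearchE`; bridge: `…ShapeCertVQFinalE`.
WHAT THIS IS NOT: no statement about STPP families or `ω` by itself; nothing about orders `> 489`.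
-/

set_option linter.dupNamespace false -- `MatrixMultiplication.MatrixMultiplication` (summit = problem, D-0017)
set_option autoImplicit false

namespace Summit.MatrixMultiplication.MatrixMultiplication.Theorems.ShapeCertVQ

open ShapeCert ShapeCertVP STPPThreeRoomEnergy

/-! ### The E3⁺ continuation budget of a prefix -/

/-- the largest pair-sum of the sides of a record -/
def mpS (t : Sh) : ℕ := max (t.a + t.b) (max (t.b + t.c) (t.c + t.a))

/-- E3⁺ continuation budget of one prefix member `t` (aggregates `A` of the prefix), `none` when it gives no constraint: requires
`2V_t > M`, untruncated slacks, the exact regime `s_A + s_B + s_C ≤ V_t`, `e3pL ≤ V_t²` and a positive slope. -/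
def qEOfT (M : ℕ) (A : Agg) (t : Sh) : Option ℕ :=
  seqN (A.sbc - t.bc) fun SA => seqN (A.sca - t.ca) fun SB => seqN (A.sab - t.ab) fun SC =>
  if M < 2 * t.V ∧ t.V + SA ≤ M ∧ t.V + SB ≤ M ∧ t.V + SC ≤ M then
    seqN (M - t.V - SA) fun sA => seqN (M - t.V - SB) fun sB => seqN (M - t.V - SC) fun sC =>
    if sA + sB + sC ≤ t.V then
      seqN (e3pL M t.V t.a t.b t.c sA sB sC) fun f => seqN (M + 1 - mpS t) fun c =>
        if f ≤ t.V * t.V ∧ 0 < c then some ((t.V * t.V - f) / c) else none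
    else none
  else none

/-- E3⁺ continuation budget of a prefix, capped by `q`: the least member budget (or `q`). -/
def qEOf (M : ℕ) (A : Agg) (fam : List Sh) (q : ℕ) : ℕ :=
  fam.foldr (fun t acc => match qEOfT M A t with | none => acc | some b => min acc b) q

/-! ### The search with the budget (verbatim `dfsQ` except for the tail budget `q`) -/

/-- The DFS with fuel: as `dfsQ`, with the tail packing budget `q = min q0 qE` at every node. -/
def dfsQE (M : ℕ) : ℕ → List Sh → List Sh → Bool
  | 0, _, _ => false
  | n + 1, fam, L =>
    (aggOf M fam).force fun A =>
      if killE M A fam then true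
      else if M * D < A.gs then false
      else if A.dead M then true
      else
        let Bs := budsOf M A fam
        if Bs.tailEmpty then decide (A.gs ≤ M * D)
        else
          let S := gnodeQ (headLevQ fam) Bs
          seqN S.bud fun gB => seqN S.idx fun gi =>
            if S.ok && decide (A.gs * K + gB * (tabGQ (headLevQ fam)).get gi ≤ M * D * K) then true
            else
              seqN (A.ra M) fun ra => seqN (A.rb M) fun rb => seqN (A.rc M) fun rc => seqN (A.vl M) fun vl =>
              seqN (A.gs * K) fun g0 => seqN (qEOf M A fam (A.q0 M)) fun q => seqN (A.kOf M) fun k =>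
              seqN (M * D * K) fun mdk =>
              seqN (breakLevQ g0 q (selOf k) mdk S.ok gB gi) fun lb1 =>
                let cl := fam.isEmpty || decide (g0 + selOf k (tabRQ loLev) * q ≤ mdk) || clAnyQ Bs g0 mdk loLev
                loopQ M (dfsQE M n) fam A ra rb rc vl g0 q (selOf k) mdk lb1 cl L

/-- The vQ certificate checker with the E3⁺ continuation budget at order `M` (`M ≤ Mtop`). -/
def checkQE (M : ℕ) : Bool := dfsQE M (M + 2) [] (candQ M)

/-! ### Root segments of `checkQE` (as `rootSegQ`; the empty prefix has no E3⁺ budget, so the root's constants are `checkQ`'s) -/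

/-- Root segment of `checkQE`: the root steps of the candidates `i, …, i + n − 1` of `candQ M` pass (children searched by `dfsQE`). -/
def rootSegQE (M i n : ℕ) : Bool :=
  (aggOf M []).force fun A =>
    seqN (A.ra M) fun ra => seqN (A.rb M) fun rb => seqN (A.rc M) fun rc => seqN (A.vl M) fun vl =>
    seqN (A.gs * K) fun g0 => seqN (A.q0 M) fun q => seqN (A.kOf M) fun k => seqN (M * D * K) fun mdk =>
    seqN (rootLb1 M) fun lb1 =>
      rootLoopQ M (dfsQE M (M + 1)) A ra rb rc vl g0 q (selOf k) mdk lb1 n ((candQ M).drop i)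

end Summit.MatrixMultiplication.MatrixMultiplication.Theorems.ShapeCertVQ
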